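import Summits.CriticalPhenomena.PercolationContinuityZ3.Theorems.PercNearOneGluingNoHeavyLowerTailSahiE3DeterminedMeetFKGFibres
import Summits.CriticalPhenomena.PercolationContinuityZ3.Theorems.PercNearOneGluingNoHeavyLowerTailC3TransportStrassen
import Mathlib.Tactic.Linarith
import Mathlib.Tactic.Ring
import HarnessLib
import HarnessLib.Audit

/-!
# `NoHeavyLowerTail` (crux stmt-CriticalPhenomena-4575), Sahi programme P4 (Holley / monotone coupling):
# SAHI'S `C₃` IS LOCAL IN THE INTERSECTION — FOR EVERY FKG WEIGHT ON EVERY FINITE DISTRIBUTIVE LATTICE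

Support file (cell `prim-l12`, seat P4; `--supports stmt-CriticalPhenomena-4575`).  No named facts, no sorries; standard axioms.  The
lemmas (ratio-monotone layer cake, objects `infFibre/cylInf/densStar`, steps 1–3) are in the companion file
`…SahiE3DeterminedMeetFKGFibres.lean`; this file does step 4 and assembles the theorems.

## The theorem (FKG version of the seat's product-measure locality theorem `…SahiE3JuntaMeet{,Block}`)

`α` a finite distributive lattice, `μ ≥ 0` log-supermodular (`μ a · μ b ≤ μ (a ⊓ b) · μ (a ⊔ b)`; zero weights allowed, not
normalised), `U, A, B` up-sets, and `w : α` such that the intersection `K = A ∩ B` is **`w`-DETERMINED**: `x ∈ K ↔ x ⊓ w ∈ K` (on a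
cube `{0,1}^{W ⊔ D}` with `w = 1_W`: `A ∩ B` depends on the coordinates `W` only; `w = c`, `K = {x | c ≤ x}` is the principal case of
`…SahiE3PrincipalMeetFKG`).  Let `A* = starUp A w = {x | ∃ a' ∈ A, a' ⊓ w ≤ x} ⊇ A`, `B*` be the TOP SECTIONS (`w`-determined up-sets,
`A* ∩ B* = K`).  THEN

  `latticeE3_nonneg_of_inter_determined`:  if `0 ≤ latticeE3 μ V A* B*` for every `w`-determined up-set `V`, then `0 ≤ latticeE3 μ U A B`.

The hypothesis is Sahi's `C₃` for a triple of `w`-CYLINDERS, i.e. (`latticeE3` of cylinders = `latticeE3` on the interval lattice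
`↓w = [⊥, w]` under the push-forward weight `ν z = μ{x | x ⊓ w = z}`, which is again log-supermodular by Ahlswede–Daykin) an instance
of `C₃` on the SMALLER lattice `↓w`.  Packaged forms: `latticeE3_nonneg_of_inter_determined_of_cylinders` (hypothesis: `C₃` for all
triples of `w`-determined up-sets of `α`) and the transport form `hasC3Flow_of_inter_determined`.  (The principal case `w = c`,
`A ∩ B = {x | c ≤ x}` — where the cylinder instance is `E₃(1, A*, B*) = Cov ≥ 0` plus dropped negative terms — is the already-landed
`SahiE3PrincipalMeetFKG.latticeE3_nonneg_of_inter_eq_principalUp`, proved there by a different route.)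
READING (minimal counterexamples): a counterexample `(α, μ; U, A, B)` to the indicator form of Sahi's Conjecture 5 at `n = 3`
[Sahi2008, Conj. 5; LiebSahi2021, Conj. 1.1] with `|α|` minimal has ALL THREE pairwise intersections `U ∩ A, U ∩ B, A ∩ B` determined by
no `w < ⊤` — on a cube: of full essential support (the product-measure version is the seat's gen-3 theorem; here for all FKG weights,
where the gen-3 fibre-local transport provably fails, HOME code/gen3/check_fkg_principal.py).

## Proof (grouping by `x ⊓ w`; a ratio-monotone layer cake replaces the fibre-local argument)

`Z = m(univ)`, `a, b, â, b̂ = m(A), m(B), m(A*), m(B*)`, `π = m(K)`.  (1) DOMINATION: the first-slot density of `(A, B)`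
(`C3Transport.density`) is pointwise `≥ densStar := 2Z²·1_K + ab − Zπ − Za·1_{B*} − Zb·1_{A*}` (`A ⊆ A*`, `B ⊆ B*`), so
`latticeE3 μ U A B ≥ Q(U) := Σ_{x∈U} μ x · densStar x`; `densStar` is `w`-determined.  (2) COMPARISON: for every up-set `V`,
`Q(V) − latticeE3 μ V A* B* = (ab − âb̂)m(V) + Z(â − a)m(V ∩ B*) + Z(b̂ − b)m(V ∩ A*) ≥ m(V)(â − a)(b̂ − b) ≥ 0` (FKG for `(V, A*)`,
`(V, B*)`) — gen 3's "tangent corner"; hence `Q(V) ≥ 0` for `w`-determined `V` by hypothesis.  (3) FIBRES: `Q(U) = Σ_z densStar z · m_U(z)`,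
`m_U(z) = m(U ∩ {x ⊓ w = z})`, `ν(z) = m{x ⊓ w = z}`; Ahlswede–Daykin (`four_functions_theorem_univ`, with `(x ⊓ y) ⊓ w = z`,
`(x ⊔ y) ⊓ w = z'` for `x ⊓ w = z ≤ z' = y ⊓ w`) gives the RATIO MONOTONICITY `m_U(z)·ν(z') ≤ ν(z)·m_U(z')` for `z ≤ z'` (Holley:
`μ(U | x ⊓ w = z)` increases with `z`).  (4) LAYER CAKE (`sum_mul_nonneg_of_ratioMonotone`, from the tree's
`Literature.Probability.LatticeModels.sum_mul_nonneg_of_upperSets` applied to the monotone envelope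
`h z = max_{z' ≤ z, ν z' > 0} m_U(z')/ν(z')`, which equals `m_U/ν` on the support): `Σ_z densStar z · m_U(z) ≥ 0` as soon as
`Σ_{z ∈ U'} densStar z · ν z ≥ 0` for all up-sets `U'` of `α` — and that sum is `Q` of the `w`-cylinder `{x | x ⊓ w ∈ U'}`, `≥ 0` by (2).
Exact census before formalising (seat folder work/pi/check_jfkg.py, Fractions; cubes `{0,1}^3, {0,1}^4`, random log-supermodular
weights with and without zeros, blocks `|W| = 2, 3`, all pairs with `W`-determined intersection × all up-sets `U`): `E₃ ≥ Q ≥ 0`,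
`Q(V) ≥ latticeE3(V, A*, B*) ≥ 0` on cylinders, ratio monotonicity — 0 violations.
-/

namespace Summit.CriticalPhenomena.PercolationContinuityZ3.Theorems.SahiE3DeterminedMeetFKG

open Finset Literature.Probability.LatticeModels
open Summit.CriticalPhenomena.PercolationContinuityZ3.Theorems.C3Transport (density latticeE3_eq_sum_density HasC3Flow
  hasC3Flow_of_forall_upperSet)
open Summit.CriticalPhenomena.PercolationContinuityZ3.Theorems.SahiE3PrincipalMeetFKG (starUp mem_starUp subset_starUp
  isUpperSet_starUp inf_mem_starUp)

variable {α : Type*} [DistribLattice α] [Fintype α] [DecidableEq α] [DecidableLE α]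

/-! ### Step 4: the cylinder sums are instances of the hypothesis -/

/-- For an up-set `U'` of `α`: `Σ_{z ∈ U'} densStar z · m(F_z) = Q({x | x ⊓ w ∈ U'})`. [this work] -/
theorem sum_densStar_mul_fibre_eq_cyl {μ : α → ℝ} {A B : Finset α} {w : α} (hK : ∀ x, x ∈ A ∩ B ↔ x ⊓ w ∈ A ∩ B)
    (U' : Finset α) :
    ∑ z ∈ U', densStar μ A B w z * mass μ (infFibre univ w z) =
      ∑ x ∈ cylInf U' w, μ x * densStar μ A B w x := by
  rw [sum_densStar_eq_sum_fibre hK]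
  have hfib : ∀ z, mass μ (infFibre (cylInf U' w) w z) = if z ∈ U' then mass μ (infFibre univ w z) else 0 := by
    intro z
    by_cases hz : z ∈ U'
    · rw [if_pos hz]
      congr 1
      ext x
      rw [mem_infFibre, mem_infFibre, mem_cylInf]
      constructor
      · rintro ⟨_, h⟩; exact ⟨Finset.mem_univ _, h⟩
      · rintro ⟨_, h⟩; exact ⟨by rw [h]; exact hz, h⟩
    · rw [if_neg hz]
      have : infFibre (cylInf U' w) w z = ∅ := by
        ext x
        rw [mem_infFibre, mem_cylInf]
        simp only [Finset.notMem_empty, iff_false, not_and]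
        intro h1 h2
        exact hz (h2 ▸ h1)
      rw [this]
      rfl
  simp only [hfib, mul_ite, mul_zero]
  rw [Finset.sum_ite_mem, Finset.univ_inter]

/-! ### The theorem -/

/-- **Sahi's `C₃` is local in the intersection, for every FKG weight.**  `μ ≥ 0` log-supermodular on a finite distributive
lattice, `U, A, B` up-sets, `A ∩ B` `w`-determined; if `latticeE3 μ V A* B* ≥ 0` for every `w`-determined up-set `V`
(`A* = starUp A w`, `B* = starUp B w`: a `C₃` instance for `w`-cylinders, i.e. on the smaller lattice `↓w`), then
`0 ≤ latticeE3 μ U A B`. [this work] -/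
theorem latticeE3_nonneg_of_inter_determined {μ : α → ℝ} (hμ₀ : 0 ≤ μ)
    (hμ : ∀ a b, μ a * μ b ≤ μ (a ⊓ b) * μ (a ⊔ b)) {U A B : Finset α}
    (hU : IsUpperSet (U : Set α)) (hA : IsUpperSet (A : Set α)) (hB : IsUpperSet (B : Set α)) (w : α)
    (hK : ∀ x, x ∈ A ∩ B ↔ x ⊓ w ∈ A ∩ B)
    (hblock : ∀ V : Finset α, IsUpperSet (V : Set α) → (∀ x, x ∈ V ↔ x ⊓ w ∈ V) →
      0 ≤ latticeE3 μ V (starUp A w) (starUp B w)) :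
    0 ≤ latticeE3 μ U A B := by
  refine le_trans ?_ (sum_densStar_le_latticeE3 hμ₀ U A B w)
  rw [sum_densStar_eq_sum_fibre hK]
  refine sum_mul_nonneg_of_ratioMonotone (densStar μ A B w) (fun z => mass μ (infFibre univ w z))
    (fun z => mass μ (infFibre U w z)) (fun z => mass_nonneg hμ₀ _) (fun z => mass_nonneg hμ₀ _)
    (fun z hz => le_antisymm ((mass_infFibre_le hμ₀ U w z).trans_eq hz) (mass_nonneg hμ₀ _))
    (fun z z' hzz' => mass_infFibre_ratio_mono hμ₀ hμ hU w hzz') (fun U' hU' => ?_)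
  show 0 ≤ ∑ z ∈ U', densStar μ A B w z * mass μ (infFibre univ w z)
  rw [sum_densStar_mul_fibre_eq_cyl hK]
  exact le_trans (hblock _ (isUpperSet_cylInf hU' w) mem_cylInf_iff_inf_mem)
    (latticeE3_star_le_sum_densStar hμ₀ hμ (isUpperSet_cylInf hU' w) hA hB hK)

/-- **Packaged locality**: if Sahi's `C₃` holds under `μ` for every triple of `w`-DETERMINED up-sets (cylinders over the block
`↓w` — an instance of `C₃` on the smaller lattice `↓w` with the push-forward weight), then it holds for every triple of up-sets whose
last two members have a `w`-determined intersection. [this work] -/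
theorem latticeE3_nonneg_of_inter_determined_of_cylinders {μ : α → ℝ} (hμ₀ : 0 ≤ μ)
    (hμ : ∀ a b, μ a * μ b ≤ μ (a ⊓ b) * μ (a ⊔ b)) (w : α)
    (hC3w : ∀ V A' B' : Finset α, IsUpperSet (V : Set α) → IsUpperSet (A' : Set α) → IsUpperSet (B' : Set α) →
      (∀ x, x ∈ V ↔ x ⊓ w ∈ V) → (∀ x, x ∈ A' ↔ x ⊓ w ∈ A') → (∀ x, x ∈ B' ↔ x ⊓ w ∈ B') → 0 ≤ latticeE3 μ V A' B')
    {U A B : Finset α} (hU : IsUpperSet (U : Set α)) (hA : IsUpperSet (A : Set α)) (hB : IsUpperSet (B : Set α))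
    (hK : ∀ x, x ∈ A ∩ B ↔ x ⊓ w ∈ A ∩ B) : 0 ≤ latticeE3 μ U A B :=
  latticeE3_nonneg_of_inter_determined hμ₀ hμ hU hA hB w hK fun V hV hVw =>
    hC3w V _ _ hV (isUpperSet_starUp A w) (isUpperSet_starUp B w) hVw (mem_starUp_iff_inf_mem A w)
      (mem_starUp_iff_inf_mem B w)

/-- **Transport form** (seat P4's `HasC3Flow`, via Strassen `…C3TransportStrassen`): under every nonnegative log-supermodular weight,
a pair of up-sets whose intersection is `w`-determined admits a `C₃`-flow (the supply `a·μ|_{B∖A} + b·μ|_{A∖B} + Cov·μ|_{(A∩B)ᶜ}`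
moves monotonically upward into `A ∩ B` within capacity `((1−a)+(1−b)−Cov)·μ|_{A∩B}`) as soon as the `w`-cylinder triples
`(V, A*, B*)` satisfy `C₃`. [this work] -/
theorem hasC3Flow_of_inter_determined {μ : α → ℝ} (hμ₀ : 0 ≤ μ)
    (hμ : ∀ a b, μ a * μ b ≤ μ (a ⊓ b) * μ (a ⊔ b)) {A B : Finset α}
    (hA : IsUpperSet (A : Set α)) (hB : IsUpperSet (B : Set α)) (w : α) (hK : ∀ x, x ∈ A ∩ B ↔ x ⊓ w ∈ A ∩ B)
    (hblock : ∀ V : Finset α, IsUpperSet (V : Set α) → (∀ x, x ∈ V ↔ x ⊓ w ∈ V) →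
      0 ≤ latticeE3 μ V (starUp A w) (starUp B w)) :
    HasC3Flow μ A B :=
  hasC3Flow_of_forall_upperSet fun _ hU => latticeE3_nonneg_of_inter_determined hμ₀ hμ hU hA hB w hK hblock

end Summit.CriticalPhenomena.PercolationContinuityZ3.Theorems.SahiE3DeterminedMeetFKG
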